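import Summits.HubbardSuperconductivity.HubbardSuperconductivity.Theorems.BalabanIRBirComplexStableXYRStubFatGaussianDomination
import HarnessLib

/-!
# Route `BalabanIR`, crux `BirComplexStableXYR` (item `stmt-HubbardSuperconductivity-14845`),
# line `fat-gaussian-defect-calculus`: stub S6 `stub_vortexPlaquetteEnergy`

Helper (`--supports`) for the crux
`Summit.HubbardSuperconductivity.HubbardSuperconductivity.Theses.BalabanIR.BirComplexStableXYR`,
line `fat-gaussian-defect-calculus` (lead skeleton `Cruxes/BirComplexStableXYR/Lines/fat_gaussian_defect_calculus.lean`),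
stub S6 `stub_vortexPlaquetteEnergy` (vortex core cost inside the fat Gaussian, card lever (iii)).

**Statement.** Write `pv x := toIocMod two_pi_pos (−π) x ∈ (−π, π]` for the principal value of an angle.  For a
phase configuration `φ : W r → ℝ` on the window and four pairwise distinct window sites `w₁, w₂, w₃, w₄`:
* the principal values around the 4-cycle sum to `2πq` for an integer `q` (the plaquette vorticity),
  `pv(φ w₁ − φ w₂) + pv(φ w₂ − φ w₃) + pv(φ w₃ − φ w₄) + pv(φ w₄ − φ w₁) = 2πq`;
* the fat-Gaussian energy of the window dominates the vortex core cost, `2π²q² ≤ Σ_w Σ_w' pv(φ w − φ w')²`.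

**Proof.** (a) `pv x = x − (toIocDiv … x)·2π` (`self_sub_toIocDiv_mul`) and the four true differences telescope
to `0`, so the cycle sum is `−2π (k₁ + k₂ + k₃ + k₄)`.  (b) Cauchy–Schwarz for four reals,
`(e₁+e₂+e₃+e₄)² ≤ 4 (e₁²+e₂²+e₃²+e₄²)`, gives `π²q² ≤ e₁²+e₂²+e₃²+e₄²`; the double sum of squares over all
ordered pairs contains the four cycle pairs and their four reverses (for each of the four distinct outer indices,
two distinct inner indices; all terms are squares), and `pv(−x)² = pv(x)²` (both principal values lie in
`(−π, π]` and have the cosine of `x`, and `cos` is injective on `[0, π]`), whence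
`Σ_w Σ_w' pv² ≥ 2 (e₁²+e₂²+e₃²+e₄²) ≥ 2π²q²`. [folklore]

Everything used is in Mathlib plus the two landed helpers `FatGaussian.abs_toIocMod_two_pi_le` and
`FatGaussian.cos_toIocMod_two_pi`; no definition and no named fact is introduced.
-/

set_option linter.dupNamespace false -- summit = problem name (single-conjunct summit), D-0017

noncomputable section

namespace Summit.HubbardSuperconductivity.HubbardSuperconductivity.Theorems.FatGaussian

open scoped BigOperators
open Summit.HubbardSuperconductivity.BirComplexStableXYNegative

/-- The squared principal value is even: `pv(−x)² = pv(x)²` for `pv = toIocMod 2π (−π)`. [folklore] -/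
theorem toIocMod_two_pi_neg_sq (x : ℝ) :
    (toIocMod Real.two_pi_pos (-Real.pi) (-x)) ^ 2 = (toIocMod Real.two_pi_pos (-Real.pi) x) ^ 2 := by
  rw [← sq_abs, ← sq_abs (toIocMod _ _ x)]
  congr 1
  refine Real.injOn_cos ⟨abs_nonneg _, abs_toIocMod_two_pi_le _⟩ ⟨abs_nonneg _, abs_toIocMod_two_pi_le _⟩ ?_
  simp only [Real.cos_abs, cos_toIocMod_two_pi, Real.cos_neg]

/-- Two distinct terms of a finite sum of nonnegative reals are bounded by the sum. [folklore] -/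
theorem add_le_sum_of_nonneg {ι : Type*} [Fintype ι] (f : ι → ℝ) (hf : ∀ i, 0 ≤ f i) {a b : ι}
    (hab : a ≠ b) : f a + f b ≤ ∑ i, f i := by
  classical
  calc f a + f b = ∑ i ∈ {a, b}, f i := (Finset.sum_pair hab).symm
    _ ≤ ∑ i, f i := Finset.sum_le_sum_of_subset_of_nonneg (Finset.subset_univ _) fun i _ _ => hf i

/-- Four pairwise distinct terms of a finite sum of nonnegative reals are bounded by the sum. [folklore] -/
theorem add_add_add_le_sum_of_nonneg {ι : Type*} [Fintype ι] (f : ι → ℝ) (hf : ∀ i, 0 ≤ f i)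
    {a b c d : ι} (hab : a ≠ b) (hac : a ≠ c) (had : a ≠ d) (hbc : b ≠ c) (hbd : b ≠ d) (hcd : c ≠ d) :
    f a + f b + f c + f d ≤ ∑ i, f i := by
  classical
  have ha : a ∉ ({b, c, d} : Finset ι) := by simp [hab, hac, had]
  have hb : b ∉ ({c, d} : Finset ι) := by simp [hbc, hbd]
  calc f a + f b + f c + f d = ∑ i ∈ {a, b, c, d}, f i := by
        rw [Finset.sum_insert ha, Finset.sum_insert hb, Finset.sum_pair hcd]
        ring
    _ ≤ ∑ i, f i := Finset.sum_le_sum_of_subset_of_nonneg (Finset.subset_univ _) fun i _ _ => hf i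

/-- Cycle extraction from a double sum of squares: if `P(−x)² = P(x)²` then for four pairwise distinct indices
`a, b, c, d` the double sum `Σ_i Σ_j P(φ i − φ j)²` dominates twice the sum of the four cycle terms
(the eight ordered pairs of the cycle are pairwise distinct). [folklore] -/
theorem two_mul_cycle_sq_le_sum_sum {ι : Type*} [Fintype ι] (P : ℝ → ℝ) (hP : ∀ x, P (-x) ^ 2 = P x ^ 2)
    (φ : ι → ℝ) {a b c d : ι} (hab : a ≠ b) (hac : a ≠ c) (had : a ≠ d) (hbc : b ≠ c) (hbd : b ≠ d)
    (hcd : c ≠ d) :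
    2 * (P (φ a - φ b) ^ 2 + P (φ b - φ c) ^ 2 + P (φ c - φ d) ^ 2 + P (φ d - φ a) ^ 2) ≤
      ∑ i, ∑ j, P (φ i - φ j) ^ 2 := by
  have hsymm : ∀ x y : ℝ, P (x - y) ^ 2 = P (y - x) ^ 2 := fun x y => by rw [← neg_sub, hP]
  have hin : ∀ i j k : ι, j ≠ k → P (φ i - φ j) ^ 2 + P (φ i - φ k) ^ 2 ≤ ∑ l, P (φ i - φ l) ^ 2 :=
    fun i j k hjk => add_le_sum_of_nonneg (fun l => P (φ i - φ l) ^ 2) (fun _ => sq_nonneg _) hjk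
  have hout : (∑ l, P (φ a - φ l) ^ 2) + (∑ l, P (φ b - φ l) ^ 2) + (∑ l, P (φ c - φ l) ^ 2) +
      (∑ l, P (φ d - φ l) ^ 2) ≤ ∑ i, ∑ j, P (φ i - φ j) ^ 2 :=
    add_add_add_le_sum_of_nonneg (fun i => ∑ l, P (φ i - φ l) ^ 2)
      (fun i => Finset.sum_nonneg fun l _ => sq_nonneg _) hab hac had hbc hbd hcd
  have ha := hin a b d hbd
  have hb := hin b a c hac
  have hc := hin c b d hbd
  have hd := hin d a c hac
  rw [hsymm (φ a) (φ d)] at ha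
  rw [hsymm (φ b) (φ a)] at hb
  rw [hsymm (φ c) (φ b)] at hc
  rw [hsymm (φ d) (φ c)] at hd
  linarith

/-- Abstract vortex plaquette energy: if `P x = x − (D x)·2π` with `D x ∈ ℤ` and `P(−x)² = P(x)²`, then around
any 4-cycle of pairwise distinct indices `Σ P = 2πq` with `q ∈ ℤ` and `2π²q² ≤ Σ_i Σ_j P(φ i − φ j)²`.
[folklore] -/
theorem vortexPlaquetteEnergy_of {ι : Type*} [Fintype ι] (P : ℝ → ℝ) (D : ℝ → ℤ)
    (hPD : ∀ x, x - (D x : ℝ) * (2 * Real.pi) = P x) (hP : ∀ x, P (-x) ^ 2 = P x ^ 2) (φ : ι → ℝ)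
    {a b c d : ι} (hab : a ≠ b) (hac : a ≠ c) (had : a ≠ d) (hbc : b ≠ c) (hbd : b ≠ d) (hcd : c ≠ d) :
    ∃ q : ℤ, P (φ a - φ b) + P (φ b - φ c) + P (φ c - φ d) + P (φ d - φ a) = 2 * Real.pi * q ∧
      2 * Real.pi ^ 2 * (q : ℝ) ^ 2 ≤ ∑ i, ∑ j, P (φ i - φ j) ^ 2 := by
  obtain ⟨q, hq⟩ : ∃ q : ℤ, P (φ a - φ b) + P (φ b - φ c) + P (φ c - φ d) + P (φ d - φ a) =
      2 * Real.pi * q := by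
    refine ⟨-(D (φ a - φ b) + D (φ b - φ c) + D (φ c - φ d) + D (φ d - φ a)), ?_⟩
    push_cast
    linear_combination -(hPD (φ a - φ b) + hPD (φ b - φ c) + hPD (φ c - φ d) + hPD (φ d - φ a))
  refine ⟨q, hq, ?_⟩
  have hT := two_mul_cycle_sq_le_sum_sum P hP φ hab hac had hbc hbd hcd
  -- Cauchy–Schwarz for the four cycle terms: `(Σ e)² ≤ 4 Σ e²`.
  have hCS : (P (φ a - φ b) + P (φ b - φ c) + P (φ c - φ d) + P (φ d - φ a)) ^ 2 ≤
      4 * (P (φ a - φ b) ^ 2 + P (φ b - φ c) ^ 2 + P (φ c - φ d) ^ 2 + P (φ d - φ a) ^ 2) := by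
    nlinarith [sq_nonneg (P (φ a - φ b) - P (φ b - φ c)), sq_nonneg (P (φ a - φ b) - P (φ c - φ d)),
      sq_nonneg (P (φ a - φ b) - P (φ d - φ a)), sq_nonneg (P (φ b - φ c) - P (φ c - φ d)),
      sq_nonneg (P (φ b - φ c) - P (φ d - φ a)), sq_nonneg (P (φ c - φ d) - P (φ d - φ a))]
  rw [hq] at hCS
  nlinarith [hCS, hT, Real.pi_pos]

/-- **Stub S6 (vortex plaquette energy in the fat Gaussian).**  For any four pairwise distinct window sites
the principal values `pv = toIocMod 2π (−π)` of the phase differences around the 4-cycle sum to `2πq` with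
`q ∈ ℤ` (the plaquette vorticity), and the window's fat-Gaussian energy `Σ_w Σ_w' pv(φ_w − φ_w')²` is at least
`2π²q²`. [folklore] -/
theorem stub_vortexPlaquetteEnergy :
    ∀ (r : ℕ) (φ : W r → ℝ) (w₁ w₂ w₃ w₄ : W r), w₁ ≠ w₂ → w₁ ≠ w₃ → w₁ ≠ w₄ → w₂ ≠ w₃ → w₂ ≠ w₄ → w₃ ≠ w₄ → ∃ q : ℤ, toIocMod Real.two_pi_pos (-Real.pi) (φ w₁ - φ w₂) + toIocMod Real.two_pi_pos (-Real.pi) (φ w₂ - φ w₃) + toIocMod Real.two_pi_pos (-Real.pi) (φ w₃ - φ w₄) + toIocMod Real.two_pi_pos (-Real.pi) (φ w₄ - φ w₁) = 2 * Real.pi * q ∧ 2 * Real.pi ^ 2 * (q : ℝ) ^ 2 ≤ ∑ w, ∑ w', (toIocMod Real.two_pi_pos (-Real.pi) (φ w - φ w')) ^ 2 := by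
  intro r φ w₁ w₂ w₃ w₄ h12 h13 h14 h23 h24 h34
  exact vortexPlaquetteEnergy_of (toIocMod Real.two_pi_pos (-Real.pi)) (toIocDiv Real.two_pi_pos (-Real.pi))
    (self_sub_toIocDiv_mul Real.two_pi_pos (-Real.pi)) toIocMod_two_pi_neg_sq φ h12 h13 h14 h23 h24 h34

end Summit.HubbardSuperconductivity.HubbardSuperconductivity.Theorems.FatGaussian

end
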